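import Summits.RiemannHypothesis.RiemannHypothesis.Theorems.GroundBartaEvenWinsBeyondArchDeflationWeightedPanels
import Summits.RiemannHypothesis.RiemannHypothesis.Theorems.GroundBartaEvenWinsBeyondArchDeflationCrossPanelsFour
import HarnessLib

/-!
# RiemannHypothesis / GroundBarta — rung 4 (`EvenWinsBeyondArch`, stmt-RiemannHypothesis-18807 / 18085):
# the deflated Temple L-side beyond `(log 5)/2` (four slots, THREE weight zones) — weighted residual Gram entries

Helper file (`--supports stmt-RiemannHypothesis-18807`), RH-free, no facts.  rh-explicit seat weil-5 (lead ruling R3-8a, 2026-08-22).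
The three-zone bridge `dt_weil{Even,Odd}GroundEnergy_ge_of_deflCert_wxa45` (prover A g11) weighs the residual Gram by
`{u | y₅ ≤ |u|}.piecewise (1/(β−2ν−κ₄−κ₅−λ)) ({u | y₄ ≤ |u|}.piecewise (1/(β−2ν−κ₄−λ)) (1/(β−2ν−λ)))` with `y₄ ≤ log 4 − c`,
`y₅ ≤ log 5 − c`.  Here: the three-zone weight `dt_wgt3 y₄ y₅ wI wM wE` in exactly that shape (`dt_wgt3_eq_piecewise`, rfl), its
evenness / measurability / bound / constancy on the y-panels when the breakpoints sit on the panel grid (`y₄ = n₁·(c/m)`,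
`y₅ = n₂·(c/m)`; panel weight `dt_wj3 n₁ n₂ wI wM wE j`), and the twins of prover B's …DeflationWeightedPanels on the four-slot
residual: `dt_whs3_of_panelQL4` (`∫ w‖r_i‖² ≤ 2 Σ_j w_j q_j`) and `dt_whcross3_of_panelQL4` (`∫ w Re(r_i r̄_k) ∈ 2 Σ_j w_j [lo_j, hi_j]`)
from the UNWEIGHTED per-panel bounds.  The generic weighted glue (`dt_residual_wnormSq_le_of_panels`, `dt_residual_wcross_mem_of_panels`,
`dt_wpanel_sq_le`, `dt_wpanel_mul_mem`) is B's, unchanged.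

References: Goerisch–Haunhorst (1985) [GoerischHaunhorst1985]; E. Bombieri, Rend. Mat. Acc. Lincei (9) 11 (2000) Thm 2 [Bombieri2000Weil].
-/

set_option linter.dupNamespace false

noncomputable section

open MeasureTheory Set Filter intervalIntegral
open scoped Topology BigOperators ComplexConjugate

namespace Summit.RiemannHypothesis.RiemannHypothesis.Theorems.EvenWinsBeyondArch

open Literature.NumberTheory.LFunctions
open Literature.Analysis.ValidatedNumerics Literature.Analysis.ValidatedNumerics.PolyMP
  Literature.Analysis.ValidatedNumerics.NumericsMP Literature.Analysis.ValidatedNumerics.ExpPoly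

/-! ## The three-zone weight -/

/-- The three-zone weight: `wI` on `|y| < y₄`, `wM` on `y₄ ≤ |y| < y₅`, `wE` on `y₅ ≤ |y|` (for `y₄ ≤ y₅`). -/
def dt_wgt3 (y₄ y₅ wI wM wE : ℝ) (y : ℝ) : ℝ :=
  {u : ℝ | y₅ ≤ |u|}.piecewise (fun _ ↦ wE) ({u : ℝ | y₄ ≤ |u|}.piecewise (fun _ ↦ wM) (fun _ ↦ wI)) y

/-- `dt_wgt3` is the bridge's nested `piecewise` weight (definitional). -/
theorem dt_wgt3_eq_piecewise (y₄ y₅ wI wM wE y : ℝ) :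
    {u : ℝ | y₅ ≤ |u|}.piecewise (fun _ ↦ wE) ({u : ℝ | y₄ ≤ |u|}.piecewise (fun _ ↦ wM) (fun _ ↦ wI)) y =
      dt_wgt3 y₄ y₅ wI wM wE y := rfl

/-- The three-zone weight as two nested two-zone weights. -/
theorem dt_wgt3_eq_wgt (y₄ y₅ wI wM wE y : ℝ) : dt_wgt3 y₄ y₅ wI wM wE y = dt_wgt y₅ (dt_wgt y₄ wI wM y) wE y := by
  classical
  simp only [dt_wgt3, dt_wgt, Set.piecewise, Set.mem_setOf_eq]

/-- The weight is even. -/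
theorem dt_wgt3_neg (y₄ y₅ wI wM wE y : ℝ) : dt_wgt3 y₄ y₅ wI wM wE (-y) = dt_wgt3 y₄ y₅ wI wM wE y := by
  rw [dt_wgt3_eq_wgt, dt_wgt3_eq_wgt, dt_wgt_neg, dt_wgt_neg]

/-- The weight is measurable. -/
theorem dt_wgt3_measurable (y₄ y₅ wI wM wE : ℝ) : Measurable (dt_wgt3 y₄ y₅ wI wM wE) := by
  classical
  refine Measurable.piecewise ?_ measurable_const (Measurable.piecewise ?_ measurable_const measurable_const)
  · exact measurableSet_le measurable_const (measurable_id.abs)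
  · exact measurableSet_le measurable_const (measurable_id.abs)

/-- The weight is bounded by `|wI| + |wM| + |wE|`. -/
theorem dt_wgt3_abs_le (y₄ y₅ wI wM wE y : ℝ) : |dt_wgt3 y₄ y₅ wI wM wE y| ≤ |wI| + |wM| + |wE| := by
  classical
  unfold dt_wgt3 Set.piecewise
  split_ifs
  · linarith [abs_nonneg wI, abs_nonneg wM]
  · linarith [abs_nonneg wI, abs_nonneg wE]
  · linarith [abs_nonneg wM, abs_nonneg wE]

section WPanels3

variable {c : ℚ} {k : ℕ} {gp : Fin k → Poly} {v F : Fin k → ℝ → ℂ}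

/-- the panel weight with breakpoints on the grid: `wI` for `j < n₁`, `wM` for `n₁ ≤ j < n₂`, `wE` for `j ≥ n₂` (via B's `dt_wj`). -/
def dt_wj3 (n₁ n₂ : ℕ) (wI wM wE : ℚ) (j : ℕ) : ℚ := dt_wj n₂ (dt_wj n₁ wI wM j) wE j

/-- On panel `j` the weight `dt_wgt3 (n₁ c/m) (n₂ c/m) wI wM wE` is the constant `dt_wj3 n₁ n₂ wI wM wE j`. -/
theorem dt_wgt3_on_panel (hc : 0 < c) {m : ℕ} (hm : 0 < m) (n₁ n₂ : ℕ) (wI wM wE : ℚ) {j : ℕ} {ρ : ℝ}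
    (hρ : ρ ∈ Ioo (-((c / (2 * m) : ℚ) : ℝ)) ((c / (2 * m) : ℚ) : ℝ)) :
    dt_wgt3 (((n₁ : ℚ) * (c / m) : ℚ) : ℝ) (((n₂ : ℚ) * (c / m) : ℚ) : ℝ) (wI : ℝ) (wM : ℝ) (wE : ℝ)
        ((((PolyMP.panelCentre (c / (2 * m)) j : ℚ) : ℝ)) + ρ) = ((dt_wj3 n₁ n₂ wI wM wE j : ℚ) : ℝ) := by
  rw [dt_wgt3_eq_wgt, dt_wgt_on_panel hc hm n₁ wI wM hρ]
  have := dt_wgt_on_panel hc hm n₂ (dt_wj n₁ wI wM j) wE hρ (j := j)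
  rw [this, dt_wj3]

/-- **Weighted residual norm** `∫ w‖F_i − Σ W v‖² ≤ 2 Σ_j w_j q_j` from the unweighted per-panel bounds (`w_j = dt_wj3 n₁ n₂ wI wM wE j ≥ 0`).
[cite: GoerischHaunhorst1985, §2] -/
theorem dt_whs3_of_panelQL4 (hc : 0 < c) {σ : ℝ} (hσ : σ = 1 ∨ σ = -1)
    (hgp : ∀ i x, Poly.eval (gp i) (-x) = σ * Poly.eval (gp i) x)
    (hv : ∀ i x, v i x = (((Icc (-(c : ℝ)) c).indicator (fun x ↦ Poly.eval (gp i) x) x : ℝ) : ℂ))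
    (hF : ∀ i y, F i y = (Icc (-(c : ℝ)) c).indicator (fun y ↦
        2 * (∫ x, v i x * (Real.cosh (x / 2) : ℂ)) * (Real.cosh (y / 2) : ℂ) -
          2 * (∫ x, v i x * (Real.sinh (x / 2) : ℂ)) * (Real.sinh (y / 2) : ℂ) +
        (∑ n ∈ weilPrimeIndex (c : ℝ), (((ArithmeticFunction.vonMangoldt n : ℝ) / Real.sqrt n : ℝ) : ℂ) *
          (2 * v i y - v i (y - Real.log n) - v i (y + Real.log n))) +
        ∫ t in Ioi 0, (weilArchDensity t : ℂ) * (2 * v i y - v i (y - t) - v i (y + t))) y -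
      (weilMarkovConstant (c : ℝ) : ℂ) * v i y)
    {w1 L1 w2 L2 w3 L3 w4 L4 : ℝ} (Mt : ℚ) (Wt : Fin k → Fin k → ℚ) (i : Fin k)
    (hprimes : ∀ y : ℝ, ∑ n ∈ weilPrimeIndex (c : ℝ), ((ArithmeticFunction.vonMangoldt n : ℝ) / Real.sqrt n) *
        (2 * Poly.eval (gp i) y - (Icc (-(c : ℝ)) c).indicator (fun x ↦ Poly.eval (gp i) x) (y - Real.log n) -
          (Icc (-(c : ℝ)) c).indicator (fun x ↦ Poly.eval (gp i) x) (y + Real.log n)) =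
      w1 * (2 * Poly.eval (gp i) y - (Icc (-(c : ℝ)) c).indicator (fun x ↦ Poly.eval (gp i) x) (y - L1) -
          (Icc (-(c : ℝ)) c).indicator (fun x ↦ Poly.eval (gp i) x) (y + L1)) +
        w2 * (2 * Poly.eval (gp i) y - (Icc (-(c : ℝ)) c).indicator (fun x ↦ Poly.eval (gp i) x) (y - L2) -
          (Icc (-(c : ℝ)) c).indicator (fun x ↦ Poly.eval (gp i) x) (y + L2)) +
        w3 * (2 * Poly.eval (gp i) y - (Icc (-(c : ℝ)) c).indicator (fun x ↦ Poly.eval (gp i) x) (y - L3) -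
          (Icc (-(c : ℝ)) c).indicator (fun x ↦ Poly.eval (gp i) x) (y + L3)) +
        w4 * (2 * Poly.eval (gp i) y - (Icc (-(c : ℝ)) c).indicator (fun x ↦ Poly.eval (gp i) x) (y - L4) -
          (Icc (-(c : ℝ)) c).indicator (fun x ↦ Poly.eval (gp i) x) (y + L4)))
    {m : ℕ} (hm : 0 < m) (n₁ n₂ : ℕ) {wI wM wE : ℚ} (hwI : 0 ≤ wI) (hwM : 0 ≤ wM) (hwE : 0 ≤ wE) (q : ℕ → ℚ)
    (hq : ∀ j, j < m →
      IntervalIntegrable (fun ρ ↦ dt_windowResidual4 (c : ℝ) gp w1 L1 w2 L2 w3 L3 w4 L4 (Mt : ℝ) (fun a l ↦ (Wt a l : ℝ)) i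
        (((PolyMP.panelCentre (c / (2 * m)) j : ℚ) : ℝ) + ρ) ^ 2) volume (-((c / (2 * m) : ℚ) : ℝ)) ((c / (2 * m) : ℚ) : ℝ) →
      ∫ ρ in (-((c / (2 * m) : ℚ) : ℝ))..((c / (2 * m) : ℚ) : ℝ),
          dt_windowResidual4 (c : ℝ) gp w1 L1 w2 L2 w3 L3 w4 L4 (Mt : ℝ) (fun a l ↦ (Wt a l : ℝ)) i
        (((PolyMP.panelCentre (c / (2 * m)) j : ℚ) : ℝ) + ρ) ^ 2 ≤ ((q j : ℚ) : ℝ)) :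
    ∫ y, dt_wgt3 (((n₁ : ℚ) * (c / m) : ℚ) : ℝ) (((n₂ : ℚ) * (c / m) : ℚ) : ℝ) (wI : ℝ) (wM : ℝ) (wE : ℝ) y *
        ‖(F i - ∑ l, ((Wt i l : ℝ) + if l = i then (Mt : ℝ) - weilMarkovConstant (c : ℝ) else 0) • v l) y‖ ^ 2 ≤
      2 * ∑ j ∈ Finset.range m, ((dt_wj3 n₁ n₂ wI wM wE j * q j : ℚ) : ℝ) := by
  have hc' : (0 : ℝ) < c := by exact_mod_cast hc
  refine dt_residual_wnormSq_le_of_panels hc' hσ (fun l x ↦ Poly.eval (gp l) x) (fun l ↦ dt_contDiff_polyEval (gp l)) hgp v F hv hF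
    (fun i l ↦ (Wt i l : ℝ) + if l = i then (Mt : ℝ) - weilMarkovConstant (c : ℝ) else 0) i hm _
    (fun _ hy ↦ dt_residual_eq_windowResidual4 hc' hv hF (Mt : ℝ) (fun a l ↦ (Wt a l : ℝ)) i hprimes hy)
    (dt_wgt3_measurable _ _ _ _ _) (fun y ↦ dt_wgt3_abs_le _ _ _ _ _ y) (fun y ↦ dt_wgt3_neg _ _ _ _ _ y)
    (fun j ↦ ((dt_wj3 n₁ n₂ wI wM wE j * q j : ℚ) : ℝ)) fun j hj ↦ ?_
  have e1 : (2 * (j : ℝ) + 1) * ((c : ℝ) / (2 * m)) = ((PolyMP.panelCentre (c / (2 * m)) j : ℚ) : ℝ) :=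
    (dt_panelCentre_castL c m j).symm
  have e2 : (c : ℝ) / (2 * m) = ((c / (2 * m) : ℚ) : ℝ) := (dt_halfWidth_cast c m).symm
  have hRi := dt_windowResidual4_sq_intervalIntegrable hc' hv hF (Mt : ℝ) (fun a l ↦ (Wt a l : ℝ)) i hprimes hm hj
  rw [e1, e2] at hRi ⊢
  have hb := hq j hj hRi
  have hw0 : (0 : ℝ) ≤ ((dt_wj3 n₁ n₂ wI wM wE j : ℚ) : ℝ) := by
    unfold dt_wj3 dt_wj; split_ifs <;> exact_mod_cast (by assumption)
  have := dt_wpanel_sq_le (w := dt_wgt3 (((n₁ : ℚ) * (c / m) : ℚ) : ℝ) (((n₂ : ℚ) * (c / m) : ℚ) : ℝ) (wI : ℝ) (wM : ℝ) (wE : ℝ))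
    (R := fun y ↦ dt_windowResidual4 (c : ℝ) gp w1 L1 w2 L2 w3 L3 w4 L4 (Mt : ℝ) (fun a l ↦ (Wt a l : ℝ)) i y)
    (y := ((PolyMP.panelCentre (c / (2 * m)) j : ℚ) : ℝ)) (by rw [← e2]; positivity) hw0
    (fun ρ hρ ↦ dt_wgt3_on_panel hc hm n₁ n₂ wI wM wE hρ) hb
  push_cast at this ⊢
  exact this

/-- **Weighted cross term** `2 Σ w_j lo_j ≤ ∫ w·Re((F_i − ΣWv)(conj(F_i' − ΣWv))) ≤ 2 Σ w_j hi_j` from the unweighted per-panel boxes.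
[cite: GoerischHaunhorst1985, §2] -/
theorem dt_whcross3_of_panelQL4 (hc : 0 < c) {σ : ℝ} (hσ : σ = 1 ∨ σ = -1)
    (hgp : ∀ i x, Poly.eval (gp i) (-x) = σ * Poly.eval (gp i) x)
    (hv : ∀ i x, v i x = (((Icc (-(c : ℝ)) c).indicator (fun x ↦ Poly.eval (gp i) x) x : ℝ) : ℂ))
    (hF : ∀ i y, F i y = (Icc (-(c : ℝ)) c).indicator (fun y ↦
        2 * (∫ x, v i x * (Real.cosh (x / 2) : ℂ)) * (Real.cosh (y / 2) : ℂ) -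
          2 * (∫ x, v i x * (Real.sinh (x / 2) : ℂ)) * (Real.sinh (y / 2) : ℂ) +
        (∑ n ∈ weilPrimeIndex (c : ℝ), (((ArithmeticFunction.vonMangoldt n : ℝ) / Real.sqrt n : ℝ) : ℂ) *
          (2 * v i y - v i (y - Real.log n) - v i (y + Real.log n))) +
        ∫ t in Ioi 0, (weilArchDensity t : ℂ) * (2 * v i y - v i (y - t) - v i (y + t))) y -
      (weilMarkovConstant (c : ℝ) : ℂ) * v i y)
    {w1 L1 w2 L2 w3 L3 w4 L4 : ℝ} (Mt : ℚ) (Wt : Fin k → Fin k → ℚ) (i i' : Fin k)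
    (hprimes : ∀ y : ℝ, ∑ n ∈ weilPrimeIndex (c : ℝ), ((ArithmeticFunction.vonMangoldt n : ℝ) / Real.sqrt n) *
        (2 * Poly.eval (gp i) y - (Icc (-(c : ℝ)) c).indicator (fun x ↦ Poly.eval (gp i) x) (y - Real.log n) -
          (Icc (-(c : ℝ)) c).indicator (fun x ↦ Poly.eval (gp i) x) (y + Real.log n)) =
      w1 * (2 * Poly.eval (gp i) y - (Icc (-(c : ℝ)) c).indicator (fun x ↦ Poly.eval (gp i) x) (y - L1) -
          (Icc (-(c : ℝ)) c).indicator (fun x ↦ Poly.eval (gp i) x) (y + L1)) +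
        w2 * (2 * Poly.eval (gp i) y - (Icc (-(c : ℝ)) c).indicator (fun x ↦ Poly.eval (gp i) x) (y - L2) -
          (Icc (-(c : ℝ)) c).indicator (fun x ↦ Poly.eval (gp i) x) (y + L2)) +
        w3 * (2 * Poly.eval (gp i) y - (Icc (-(c : ℝ)) c).indicator (fun x ↦ Poly.eval (gp i) x) (y - L3) -
          (Icc (-(c : ℝ)) c).indicator (fun x ↦ Poly.eval (gp i) x) (y + L3)) +
        w4 * (2 * Poly.eval (gp i) y - (Icc (-(c : ℝ)) c).indicator (fun x ↦ Poly.eval (gp i) x) (y - L4) -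
          (Icc (-(c : ℝ)) c).indicator (fun x ↦ Poly.eval (gp i) x) (y + L4)))
    (hprimes' : ∀ y : ℝ, ∑ n ∈ weilPrimeIndex (c : ℝ), ((ArithmeticFunction.vonMangoldt n : ℝ) / Real.sqrt n) *
        (2 * Poly.eval (gp i') y - (Icc (-(c : ℝ)) c).indicator (fun x ↦ Poly.eval (gp i') x) (y - Real.log n) -
          (Icc (-(c : ℝ)) c).indicator (fun x ↦ Poly.eval (gp i') x) (y + Real.log n)) =
      w1 * (2 * Poly.eval (gp i') y - (Icc (-(c : ℝ)) c).indicator (fun x ↦ Poly.eval (gp i') x) (y - L1) -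
          (Icc (-(c : ℝ)) c).indicator (fun x ↦ Poly.eval (gp i') x) (y + L1)) +
        w2 * (2 * Poly.eval (gp i') y - (Icc (-(c : ℝ)) c).indicator (fun x ↦ Poly.eval (gp i') x) (y - L2) -
          (Icc (-(c : ℝ)) c).indicator (fun x ↦ Poly.eval (gp i') x) (y + L2)) +
        w3 * (2 * Poly.eval (gp i') y - (Icc (-(c : ℝ)) c).indicator (fun x ↦ Poly.eval (gp i') x) (y - L3) -
          (Icc (-(c : ℝ)) c).indicator (fun x ↦ Poly.eval (gp i') x) (y + L3)) +
        w4 * (2 * Poly.eval (gp i') y - (Icc (-(c : ℝ)) c).indicator (fun x ↦ Poly.eval (gp i') x) (y - L4) -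
          (Icc (-(c : ℝ)) c).indicator (fun x ↦ Poly.eval (gp i') x) (y + L4)))
    {m : ℕ} (hm : 0 < m) (n₁ n₂ : ℕ) {wI wM wE : ℚ} (hwI : 0 ≤ wI) (hwM : 0 ≤ wM) (hwE : 0 ≤ wE) (lo hi : ℕ → ℚ)
    (hq : ∀ j, j < m →
      IntervalIntegrable (fun ρ ↦ dt_windowResidual4 (c : ℝ) gp w1 L1 w2 L2 w3 L3 w4 L4 (Mt : ℝ) (fun a l ↦ (Wt a l : ℝ)) i
        (((PolyMP.panelCentre (c / (2 * m)) j : ℚ) : ℝ) + ρ) ^ 2) volume (-((c / (2 * m) : ℚ) : ℝ)) ((c / (2 * m) : ℚ) : ℝ) →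
      IntervalIntegrable (fun ρ ↦ dt_windowResidual4 (c : ℝ) gp w1 L1 w2 L2 w3 L3 w4 L4 (Mt : ℝ) (fun a l ↦ (Wt a l : ℝ)) i'
        (((PolyMP.panelCentre (c / (2 * m)) j : ℚ) : ℝ) + ρ) ^ 2) volume (-((c / (2 * m) : ℚ) : ℝ)) ((c / (2 * m) : ℚ) : ℝ) →
      IntervalIntegrable (fun ρ ↦
        dt_windowResidual4 (c : ℝ) gp w1 L1 w2 L2 w3 L3 w4 L4 (Mt : ℝ) (fun a l ↦ (Wt a l : ℝ)) i
        (((PolyMP.panelCentre (c / (2 * m)) j : ℚ) : ℝ) + ρ) *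
        dt_windowResidual4 (c : ℝ) gp w1 L1 w2 L2 w3 L3 w4 L4 (Mt : ℝ) (fun a l ↦ (Wt a l : ℝ)) i'
        (((PolyMP.panelCentre (c / (2 * m)) j : ℚ) : ℝ) + ρ)) volume (-((c / (2 * m) : ℚ) : ℝ)) ((c / (2 * m) : ℚ) : ℝ) →
      ((lo j : ℚ) : ℝ) ≤ ∫ ρ in (-((c / (2 * m) : ℚ) : ℝ))..((c / (2 * m) : ℚ) : ℝ),
          dt_windowResidual4 (c : ℝ) gp w1 L1 w2 L2 w3 L3 w4 L4 (Mt : ℝ) (fun a l ↦ (Wt a l : ℝ)) i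
        (((PolyMP.panelCentre (c / (2 * m)) j : ℚ) : ℝ) + ρ) *
          dt_windowResidual4 (c : ℝ) gp w1 L1 w2 L2 w3 L3 w4 L4 (Mt : ℝ) (fun a l ↦ (Wt a l : ℝ)) i'
        (((PolyMP.panelCentre (c / (2 * m)) j : ℚ) : ℝ) + ρ) ∧
      ∫ ρ in (-((c / (2 * m) : ℚ) : ℝ))..((c / (2 * m) : ℚ) : ℝ),
          dt_windowResidual4 (c : ℝ) gp w1 L1 w2 L2 w3 L3 w4 L4 (Mt : ℝ) (fun a l ↦ (Wt a l : ℝ)) i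
        (((PolyMP.panelCentre (c / (2 * m)) j : ℚ) : ℝ) + ρ) *
          dt_windowResidual4 (c : ℝ) gp w1 L1 w2 L2 w3 L3 w4 L4 (Mt : ℝ) (fun a l ↦ (Wt a l : ℝ)) i'
        (((PolyMP.panelCentre (c / (2 * m)) j : ℚ) : ℝ) + ρ) ≤ ((hi j : ℚ) : ℝ)) :
    2 * ∑ j ∈ Finset.range m, ((dt_wj3 n₁ n₂ wI wM wE j * lo j : ℚ) : ℝ) ≤
      ∫ y, dt_wgt3 (((n₁ : ℚ) * (c / m) : ℚ) : ℝ) (((n₂ : ℚ) * (c / m) : ℚ) : ℝ) (wI : ℝ) (wM : ℝ) (wE : ℝ) y *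
        ((F i - ∑ l, ((Wt i l : ℝ) + if l = i then (Mt : ℝ) - weilMarkovConstant (c : ℝ) else 0) • v l) y *
          conj ((F i' - ∑ l, ((Wt i' l : ℝ) + if l = i' then (Mt : ℝ) - weilMarkovConstant (c : ℝ) else 0) • v l) y)).re ∧
    ∫ y, dt_wgt3 (((n₁ : ℚ) * (c / m) : ℚ) : ℝ) (((n₂ : ℚ) * (c / m) : ℚ) : ℝ) (wI : ℝ) (wM : ℝ) (wE : ℝ) y *
        ((F i - ∑ l, ((Wt i l : ℝ) + if l = i then (Mt : ℝ) - weilMarkovConstant (c : ℝ) else 0) • v l) y *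
          conj ((F i' - ∑ l, ((Wt i' l : ℝ) + if l = i' then (Mt : ℝ) - weilMarkovConstant (c : ℝ) else 0) • v l) y)).re ≤
      2 * ∑ j ∈ Finset.range m, ((dt_wj3 n₁ n₂ wI wM wE j * hi j : ℚ) : ℝ) := by
  have hc' : (0 : ℝ) < c := by exact_mod_cast hc
  refine dt_residual_wcross_mem_of_panels hc' hσ (fun l x ↦ Poly.eval (gp l) x) (fun l ↦ dt_contDiff_polyEval (gp l)) hgp v F hv hF
    (fun i l ↦ (Wt i l : ℝ) + if l = i then (Mt : ℝ) - weilMarkovConstant (c : ℝ) else 0) i i' hm _ _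
    (fun _ hy ↦ dt_residual_eq_windowResidual4 hc' hv hF (Mt : ℝ) (fun a l ↦ (Wt a l : ℝ)) i hprimes hy)
    (fun _ hy ↦ dt_residual_eq_windowResidual4 hc' hv hF (Mt : ℝ) (fun a l ↦ (Wt a l : ℝ)) i' hprimes' hy)
    (dt_wgt3_measurable _ _ _ _ _) (fun y ↦ dt_wgt3_abs_le _ _ _ _ _ y) (fun y ↦ dt_wgt3_neg _ _ _ _ _ y)
    (fun j ↦ ((dt_wj3 n₁ n₂ wI wM wE j * lo j : ℚ) : ℝ)) (fun j ↦ ((dt_wj3 n₁ n₂ wI wM wE j * hi j : ℚ) : ℝ)) (fun j hj ↦ ?_) (fun j hj ↦ ?_)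
  all_goals
    have e1 : (2 * (j : ℝ) + 1) * ((c : ℝ) / (2 * m)) = ((PolyMP.panelCentre (c / (2 * m)) j : ℚ) : ℝ) :=
      (dt_panelCentre_castL c m j).symm
    have e2 : (c : ℝ) / (2 * m) = ((c / (2 * m) : ℚ) : ℝ) := (dt_halfWidth_cast c m).symm
    have hR1 := dt_windowResidual4_sq_intervalIntegrable hc' hv hF (Mt : ℝ) (fun a l ↦ (Wt a l : ℝ)) i hprimes hm hj
    have hR2 := dt_windowResidual4_sq_intervalIntegrable hc' hv hF (Mt : ℝ) (fun a l ↦ (Wt a l : ℝ)) i' hprimes' hm hj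
    have hR3 := dt_windowResidual4_mul_intervalIntegrableL hc hv hF Mt Wt i i' hprimes hprimes' hm hj
    rw [e1, e2] at hR1 hR2 ⊢
    have hb := hq j hj hR1 hR2 hR3
    have hw0 : (0 : ℝ) ≤ ((dt_wj3 n₁ n₂ wI wM wE j : ℚ) : ℝ) := by
      unfold dt_wj3 dt_wj; split_ifs <;> exact_mod_cast (by assumption)
    have key := dt_wpanel_mul_mem (w := dt_wgt3 (((n₁ : ℚ) * (c / m) : ℚ) : ℝ) (((n₂ : ℚ) * (c / m) : ℚ) : ℝ) (wI : ℝ) (wM : ℝ) (wE : ℝ))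
      (Ri := fun y ↦ dt_windowResidual4 (c : ℝ) gp w1 L1 w2 L2 w3 L3 w4 L4 (Mt : ℝ) (fun a l ↦ (Wt a l : ℝ)) i y)
      (Rk := fun y ↦ dt_windowResidual4 (c : ℝ) gp w1 L1 w2 L2 w3 L3 w4 L4 (Mt : ℝ) (fun a l ↦ (Wt a l : ℝ)) i' y)
      (y := ((PolyMP.panelCentre (c / (2 * m)) j : ℚ) : ℝ)) (by rw [← e2]; positivity) hw0
      (fun ρ hρ ↦ dt_wgt3_on_panel hc hm n₁ n₂ wI wM wE hρ) hb.1 hb.2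
    push_cast at key ⊢
  · exact key.1
  · exact key.2

end WPanels3

end Summit.RiemannHypothesis.RiemannHypothesis.Theorems.EvenWinsBeyondArch

end
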